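import Summits.QuantumFields.BalabanUV.T4Continuum.Support.InsertionChannelRealify
import Summits.QuantumFields.BalabanUV.T4Continuum.Support.InsertionChannelFamilyComplex

/-!
# InsertionChannelRealifyEnd — the ONE-APPLICATION junction of the input-side realification dictionary (`InsertionChannelRealify`)
# with the channel road's complex part (leaf-06 `InsertionChannelFamilyComplex`, part 5): the inserted history entry IS the complex
# channel output (no cast), and the owner's Re∕Im END for per-point slots reading the realified channel, gain `2·c`
# (cell `pub-balaban`, T⁴ fan-out; row NE5, node U3; R48-F ROAD D of record, `HOME/CLAIMS.log` l.16073; INTENT l.19082 + addendum)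

Unit `b2b-balaban-t4-ne5-formalise-leaf-02` (NE5 formalisation swarm, leaf prover 02, gen 18).  Summits-side NEW WORK under the LEAN
PLACEMENT RULE (cell modelling + bookkeeping over ABSTRACT carriers; nothing of the manuscripts under audit is asserted; 0 cite tags; no
`Prop`-valued fact minted — the one `def` is DATA: the doubled output-index map).  HONEST FRAMING: rung (B)+1 of the FINITE-VOLUME T⁴
continuum programme — NOT infinite volume, NOT a mass gap, NOT the Clay problem, NOT a proof of NE5 (`T4OutputRate.NE5`, NOT PRINTED;
cell GAPS G-t4-U3-1) nor of NE9; spine 0/9 unchanged; 0/12 leaves instantiated on Bałaban's concrete objects (O1 = the substrate cell,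
owner R34).  HONEST DEPENDENCY (cell line, verbatim): continuum YM on T⁴ ⇐ BetaPertH ∧ nine spine estimates (0/9 proved); BetaPertH ⇐
(D1) ∧ (D4) ∧ CAP+tail; G-an2-4 gates asym, D1 and NE2/3/4.

WHY.  `InsertionChannelRealify` reads a COMPLEX localization channel `Tc` on complex background families as row NE9's REAL channel
`realify Tc` on the doubled chart `𝒰 × Fin 2` (structure binders exactly, size binder with profile `√2·τ`); leaf-06's part 5 inserts, at
every row of a complex point, the ONE history `insAtOfChannelC T out` of a real two-output channel `T` and discharges the owner's `hdamp`
with gain `√2·c`.  Composing the two with the doubled output map `outRows outc (u, r) i := (outc u i, r)`: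
* `read_insAtC_realify_succ` — THE JUNCTION: `F.read (insAtOfChannelC (realify Tc) (outRows outc) g (k+1) t (u, j)) i =
  Tc k g (complexify (toBgFamily t)) (outc u i)` — [Balaban1988RG2Cluster] (1.33) p. 9 at the complex background `u` with the earlier
  terms as the complex family of the two-row table, VERBATIM the complex operator's output (one modulus level bound at `u` suffices);
* **`ne5_of_pointwiseSlots_reIm_realify`** — leaf-06's `ne5_of_pointwiseSlots_reIm_insAtC` (= the owner's g35-e END
  `OutputRateFunctionalTablesComplexPointwise.ne5_of_pointwiseSlots_reIm` with `hdamp` discharged) at `T := realify Tc`,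
  `out := outRows outc`, with row NE9's real letters on the doubled chart DISCHARGED FROM THE COMPLEX CHANNEL's OWN DISPLAYED LETTERS
  (additivity, locality in agreement form, per-creation-step size with MODULUS majorant and profile `τ k j ≤ c·ω^{k−j}`, row-free weight
  dictionary on `wtc ∘ outc`); gain `2·c` = `√2` (input side) × `√2` (output side, part 5 §0) × `c` — the factor `2` of
  `NE9ComplexEncoding.norm_sub_le_of_ne9_reIm` by another route; conclusion LITERALLY `NE5 EA EB W κ θ (4G(δ+δ′)(θ−ω)∕(θ−(1+4G(2c∕ω))ω))`
  over the ORIGINAL carriers along the real section `ι'`.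
NOT IN THIS FILE.  No instance (which `Tc`, `outc`, `wtc` serve the record is the substrate's O-8 ∕ D-8 reading); the complex channel's
letters are HYPOTHESES; no NE9 binder discharged for Bałaban's operator; no W1 ∕ W2 ∕ representation hypothesis touched.  Headline
wording: «Road D complex chart — realified complex channel plugged into the channel road's complex END, junction only»; never «leaf
instantiated».  NE5 NOT PROVED; NE9 NOT PROVED; spine 0/9; rung (B)+1 finite T⁴; NOT infinite volume ∕ mass gap ∕ Clay.
Axioms ⊆ {propext, Classical.choice, Quot.sound}.
-/

noncomputable section

namespace Summit.QuantumFields.BalabanUV.T4Continuum.InsertionChannelRealifyEnd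

open Summit.QuantumFields.BalabanUV.T4Continuum.InsertionChannelRealify

open scoped BigOperators
open Finset Function Set Metric Complex
open Literature.MathematicalPhysics.QuantumFieldTheory.Balaban1983to89
open Literature.MathematicalPhysics.QuantumFieldTheory.Balaban1983to89.T4OutputRate (Carriers Functional NE5)
open Literature.MathematicalPhysics.QuantumFieldTheory.Balaban1983to89.T4InputCauchyRateData (tableA tableB)
open Summit.QuantumFields.BalabanUV.T4Continuum.B13HistDatum (HistFrame Hist)
open Summit.QuantumFields.BalabanUV.T4Continuum.OutputRateFunctionalTablesFamily (toBgFamily)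
open Summit.QuantumFields.BalabanUV.T4Continuum.OutputRateFunctionalTablesPointwise (PointwiseSlots)
open Summit.QuantumFields.BalabanUV.T4Continuum.OutputRateFunctionalTablesComplex (reImTab abs_reIm_le)
open Summit.QuantumFields.BalabanUV.T4Continuum.InsertionChannelFamily
  (chanEntries insAtOfChannelC read_insAtC_succ ne5_of_pointwiseSlots_reIm_insAtC)

/-! ## §1 The junction: the inserted entry is the complex channel output -/

section Junction

variable {C : Carriers} {𝒰 ιc : Type} {F : HistFrame C}

/-- [folklore] DATA: the DOUBLED OUTPUT MAP of a complex output-index map `outc : 𝒰 → F.Idx → ιc` — entry `i` at the row `r` of the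
complex point `u` reads the output row `r` of the complex index `outc u i` (row `0` ↦ real part, row `1` ↦ imaginary part). -/
def outRows (outc : 𝒰 → F.Idx → ιc) : 𝒰 × Fin 2 → F.Idx → ιc × Fin 2 := fun w i => (outc w.1 i, w.2)

/-- [folklore] `outRows`, evaluated. -/
@[simp] theorem outRows_apply (outc : 𝒰 → F.Idx → ιc) (w : 𝒰 × Fin 2) (i : F.Idx) : outRows outc w i = (outc w.1 i, w.2) := rfl

variable (Tc : ℕ → (ℕ → ℝ) → (𝒰 → C.Dom → ℂ) → ιc → ℂ) (outc : 𝒰 → F.Idx → ιc)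

/-- [folklore] A MODULUS level bound on the complex outputs at `u` gives the level bounds of BOTH rows of channel entries of the
realified channel (the hypotheses of part 5's `read_insAtC_succ`). -/
theorem chanEntries_realify_levelBounded {k : ℕ} {g : ℕ → ℝ} {t : C.Dom × (𝒰 × Fin 2) → ℝ} {u : 𝒰}
    (h : ∃ μ : ℝ, ∀ i, ‖Tc k g (complexify (toBgFamily t)) (outc u i)‖ ≤ μ * F.wt i) (r : Fin 2) :
    ∃ μ : ℝ, ∀ i, ‖chanEntries (realify Tc) (outRows outc) k g t (u, r) i‖ ≤ μ * F.wt i := by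
  obtain ⟨μ, hμ⟩ := h
  refine ⟨μ, fun i => ?_⟩
  rw [chanEntries, Complex.norm_real, Real.norm_eq_abs, outRows_apply]
  exact (abs_realify_le Tc k g (toBgFamily t) _).trans (hμ i)

/-- [folklore] **THE JUNCTION — THE INSERTED ENTRY IS THE COMPLEX CHANNEL OUTPUT, NO CAST**: for the realified channel with the doubled
output map, part 5's complex function-table reading `read_insAtC_succ` returns LITERALLY `Tc k g (complexify (toBgFamily t)) (outc u i)`
— [II] (1.33) at the complex background `u` with the earlier terms as the complex family `complexify (toBgFamily t)` of the two-row
table (one modulus level bound on the outputs at `u` suffices). -/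
theorem read_insAtC_realify_succ {k : ℕ} {g : ℕ → ℝ} {t : C.Dom × (𝒰 × Fin 2) → ℝ} {u : 𝒰}
    (h : ∃ μ : ℝ, ∀ i, ‖Tc k g (complexify (toBgFamily t)) (outc u i)‖ ≤ μ * F.wt i) (j : Fin 2) (i : F.Idx) :
    F.read (insAtOfChannelC (realify Tc) (outRows outc) g (k + 1) t (u, j)) i = Tc k g (complexify (toBgFamily t)) (outc u i) := by
  rw [read_insAtC_succ (realify Tc) (outRows outc) (chanEntries_realify_levelBounded Tc outc h 0)
    (chanEntries_realify_levelBounded Tc outc h 1), outRows_apply, outRows_apply]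
  exact re_add_I_im_realify Tc k g (toBgFamily t) (outc u i)

end Junction

/-! ## §2 The owner's Re∕Im END for per-point slots reading the realified complex channel, gain `2·c` -/

section End

variable {C : Carriers} {𝒰 ιc : Type} {F : HistFrame C} {Tc : ℕ → (ℕ → ℝ) → (𝒰 → C.Dom → ℂ) → ιc → ℂ} {outc : 𝒰 → F.Idx → ιc}
variable {Op : Type*} [NormedAddCommGroup Op] [NormedSpace ℂ Op] (P : PointwiseSlots C (𝒰 × Fin 2) Op (Hist F))

/-- [folklore] `√2·√2·c = 2·c`. -/
theorem sqrt_two_mul_sqrt_two_mul (c : ℝ) : Real.sqrt 2 * (Real.sqrt 2 * c) = 2 * c := by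
  rw [← mul_assoc, Real.mul_self_sqrt zero_le_two]

/-- [folklore] **END — `T4OutputRate.NE5 EA EB` OVER THE ORIGINAL CARRIERS FOR SLOTS ON THE COMPLEX TWO-ROW CHART WHOSE RUN-A INSERTION
READS THE REALIFICATION OF A COMPLEX CHANNEL**: leaf-06's `ne5_of_pointwiseSlots_reIm_insAtC` (the owner's g35-e END with `hdamp`
discharged) at `T := realify Tc`, `out := outRows outc`, with row NE9's real letters on the doubled chart DISCHARGED FROM THE COMPLEX
CHANNEL's OWN DISPLAYED LETTERS (§3: additivity, locality in agreement form, the per-creation-step size binder with MODULUS majorant and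
profile `τ k j ≤ c·ω^{k−j}`, the row-free weight dictionary on `wtc ∘ outc`).  Gain `2·c` = `√2` (input side, `channelSizeAtStepNN_realify`)
× `√2` (output side, part 5 §0) × `c`.  Every other hypothesis VERBATIM part 5's; conclusion LITERALLY
`NE5 EA EB W κ θ (4G(δ+δ′)(θ−ω)∕(θ−(1+4G(2c∕ω))ω))`.  Nothing of row NE9 or of [II] is asserted: the complex letters are hypotheses. -/
theorem ne5_of_pointwiseSlots_reIm_realify [Nonempty 𝒰] {ℰA ℰB : (ℕ → ℝ) → 𝒰 → C.Dom → ℂ} {EA : Functional C C.BgA}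
    {EB : Functional C C.BgB} {W : Set (ℕ → ℝ)} {κ G E₀ δ δ' θ c ω : ℝ} {wtc : ℕ → ιc → ℝ} {τ : ℕ → ℕ → ℝ}
    (hbdA : ∀ g ∈ W, ∀ k, BddAbove (Set.range fun w => ‖P.insA g k (tableA (reImTab (C := C) ℰA) g PUnit.unit) w‖))
    (hbdB : ∀ g ∈ W, ∀ k, BddAbove (Set.range fun w => ‖P.insB g k (tableB (reImTab (C := C) ℰB) g PUnit.unit) w‖))
    (hrA : ∀ g ∈ W, ∀ (X : C.Dom) (u : 𝒰) (i : Fin 2), ℰA g u X =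
      P.Out (C.scale X) (P.opA g (C.scale X) (u, i))
        (P.insA g (C.scale X) (tableA (reImTab (C := C) ℰA) g PUnit.unit) (u, i)) X)
    (hrB : ∀ g ∈ W, ∀ (X : C.Dom) (u : 𝒰) (i : Fin 2), ℰB g u X =
      P.Out (C.scale X) (P.opB g (C.scale X) (u, i))
        (P.insB g (C.scale X) (tableB (reImTab (C := C) ℰB) g PUnit.unit) (u, i)) X)
    (hbase : ∀ k, ∀ g ∈ W, ∀ w,
      (P.opB g k w, P.insB g k (tableB (reImTab (C := C) ℰB) g PUnit.unit) w) ∈ P.Base k g w)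
    (henv : ∀ k, ∀ g ∈ W, ∀ w, ∀ q ∈ P.Base k g w, ∀ X : C.Dom, C.scale X = k →
      DifferentiableOn ℂ (fun z : Op × Hist F => P.Out k z.1 z.2 X) (closedBall q.1 (P.rOp k) ×ˢ closedBall q.2 (P.rHist k)) ∧
        ∀ z ∈ closedBall q.1 (P.rOp k) ×ˢ closedBall q.2 (P.rHist k), ‖P.Out k z.1 z.2 X‖ ≤ G * Real.exp (-(κ * C.d X)))
    (hdA : ∀ g ∈ W, ∀ (u : 𝒰) (X : C.Dom), ‖ℰA g u X‖ ≤ G * Real.exp (-(κ * C.d X)))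
    (hdB : ∀ g ∈ W, ∀ (u : 𝒰) (X : C.Dom), ‖ℰB g u X‖ ≤ E₀ * Real.exp (-(κ * C.d X))) (hE₀ : E₀ ≤ G)
    (hop : ∀ k, ∀ g ∈ W, ∀ w : 𝒰 × Fin 2, ‖P.opA g k w - P.opB g k w‖ ≤ δ * θ ^ k * P.rOp k)
    (hinsRate : ∀ k, ∀ g ∈ W, ∀ (t : C.Dom × (𝒰 × Fin 2) → ℝ), (∀ Y w, |t (Y, w)| ≤ E₀ * Real.exp (-(κ * C.d Y))) →
      ∀ w, ‖P.insA g k t w - P.insB g k t w‖ ≤ δ' * θ ^ k * P.rHist k)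
    (hins : ∀ k, ∀ g ∈ W, ∀ (t : C.Dom × (𝒰 × Fin 2) → ℝ) (w : 𝒰 × Fin 2),
      P.insA g k t w = insAtOfChannelC (realify Tc) (outRows outc) g k t w)
    (haddC : ∀ (k : ℕ) (s : ℕ → ℝ) (H₁ H₂ : 𝒰 → C.Dom → ℂ) (y : ιc), Tc k s (H₁ - H₂) y = Tc k s H₁ y - Tc k s H₂ y)
    (hlocC : ∀ (k : ℕ) (s : ℕ → ℝ) (H H' : 𝒰 → C.Dom → ℂ), (∀ u X, C.scale X ≤ k → H u X = H' u X) →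
      ∀ y : ιc, Tc k s H y = Tc k s H' y)
    (hsizeC : ∀ (k j : ℕ), j ≤ k → ∀ (s : ℕ → ℝ) (H : 𝒰 → C.Dom → ℂ), (∀ u X, C.scale X ≠ j → H u X = 0) →
      ∀ N : ℝ, 0 ≤ N → (∀ u X, C.scale X = j → ‖H u X‖ ≤ Real.exp (-(κ * C.d X)) * N) →
        ∀ y : ιc, ‖Tc k s H y‖ ≤ wtc k y * (τ k j * N))
    (hwt0 : ∀ k u i, 0 ≤ wtc k (outc u i)) (hwt : ∀ k u i, wtc k (outc u i) ≤ P.rHist (k + 1) * F.wt i)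
    (hτ : ∀ k j, j ≤ k → τ k j ≤ c * ω ^ (k - j))
    (hG : 0 ≤ G) (hδ : 0 ≤ δ + δ') (hc : 0 ≤ c) (hω : 0 < ω) (hsmall : (1 + 4 * G * (2 * c / ω)) * ω < θ)
    (ι' : C.BgB → 𝒰) (hιA : ∀ g ∈ W, ∀ (U : C.BgB) (X : C.Dom), EA g (C.transport U) X = (ℰA g (ι' U) X).re)
    (hιB : ∀ g ∈ W, ∀ (U : C.BgB) (X : C.Dom), EB g U X = (ℰB g (ι' U) X).re) :
    NE5 EA EB W κ θ (4 * G * (δ + δ') * (θ - ω) / (θ - (1 + 4 * G * (2 * c / ω)) * ω)) := by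
  have key := ne5_of_pointwiseSlots_reIm_insAtC P hbdA hbdB hrA hrB hbase henv hdA hdB hE₀ hop hinsRate hins
    (channelAdditive_realify haddC) (channelStepSum_realify haddC hlocC) (channelSizeAtStepNN_realify hsizeC)
    (fun k w i => hwt0 k w.1 i) (fun k w i => hwt k w.1 i) (profile_sqrt_two hτ) hG hδ
    (mul_nonneg (Real.sqrt_nonneg _) hc) hω (by rwa [sqrt_two_mul_sqrt_two_mul]) ι' hιA hιB
  rwa [sqrt_two_mul_sqrt_two_mul] at key

end End

end Summit.QuantumFields.BalabanUV.T4Continuum.InsertionChannelRealifyEnd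

end
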